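import Mathlib.NumberTheory.Padics.PadicVal.Basic
import Mathlib.RingTheory.Ideal.Span
import Mathlib.RingTheory.PrincipalIdealDomain
import Mathlib.Algebra.Module.Submodule.Range
import HarnessLib

/-!
# Route `RamifiedHeegnerPair`, crux U₁ `LeafRankOneUpperAtThree` (stmt-BirchSwinnertonDyer-26022), line `partnerdescent` —
# partner kernel: the (G3♭ˢ) fifth property in Takahashi–Papikian–Rabinoff COORDINATES (`ℓ ∤ j ⟺ ord_ℓ δ = ord_ℓ R`, `R = h/i` = the denominator of the orthogonal idempotent)

HONEST FRAMING. Theorems only; helper file (`--supports stmt-BirchSwinnertonDyer-26022 --as helper`); elementary lattice arithmetic over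
Mathlib in the ABSTRACT setting of the tree's `Literature.NumberTheory.EllipticCurves.Takahashi2001.exists_index_formula`
(`TakahashiDegreeFormulaProofs.lean`: a `ℤ`-bilinear pairing `u_J` on the character group `X_J`, a generator `g` of the `f`-line,
`i` the positive generator of the ideal `{u_J(g, y)}`, `h = u_J(g, g)`, and `δ·i = h·j`); no number theory, no named fact, no `sorry`;
nothing booked; BSD is proved for no curve. Lead prover bsd-line-rhp-p2 g61, 2026-08-31. Companion of
`…LeafPartnerOrdersGorensteinCore` (the algebra of the derivation's Steps 1–3).

WHY. In the tree's Brandt coordinates the Skolem cokernel order `j = cJ P r` of the stub (G3♭ˢ) is (any, hence the unique) solution of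
Takahashi's system `i·j = c_r`, `δ·i = ξ·j` (`…RibetTakahashiComponentOrdersCoordinatesProofs`, `…BrandtDictionaryProofs` `hDictDisc`,
Takahashi 2001 Thm. 2.3 with Thm. 3.2 (a)), where `δ = P.deg = δ_{qr,M}`, `ξ = h = u_J(g,g)` is the self-pairing of the `f`-line generator
and `i` generates `{u_J(g, y) : y ∈ X_J}` (Lemma 2.2). Papikian–Rabinoff (arXiv:1212.3574 §3 ¶23–¶25, Thm. 30, held text read) write the
same number as `c = n/r` with `n = δ` and `r` = the denominator of the idempotent `e = e_f` on the lattice `Λ = X_J`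
(`= [Λ : λ^⊥ ⊕ ℤλ]`, Thm. 30 (4)⟺(7)). This file proves the dictionary between the two in the abstract setting:

* `forall_dvd_mul_pairing_iff` — **the denominator of `e_g` on `X_J` is `R := h/i`**: `a·e_g` is integral on `X_J`
  (`h ∣ a·u_J(g, y)` for all `y`, i.e. `a·u_J(g,y)/h · g ∈ X_J`) iff `h/i ∣ a`. So PR's `r` is Takahashi's `h_r/i_r`.
* `not_dvd_iff_padicValNat_eq` — **the fifth property in coordinates**: from `δ·i = h·j`, `i ∣ h`, `δ > 0`:
  `ℓ ∤ j ⟺ ord_ℓ δ = ord_ℓ (h/i)` — i.e. (G3♭ˢ) at `(V; qr, M; r)` says exactly `ord₃ δ_{qr,M} = ord₃ R` with `R` the denominator of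
  `e_f` on `X_r(J′)`, the quantity the derivation's Step 3 (`LeafPartnerOrders.denominators_eq_of_canonicalModule`) identifies with the
  `3`-adic congruence exponent of `f` in `𝕋′_𝔪`; equivalently `ord₃ δ_{qr,M} + ord₃ c_r(A) = ord₃ ξ` (`padicValNat_add_eq_iff_not_dvd`),
  the form the (G3) instrument reads (LEAD-G57-G3-LEDGER.md: 424501b1 at `7`: `ord₃ 82944 + ord₃ 9 = 4 + 2 = 6 = ord₃ 746496`).

[cite: Takahashi2001, Lemma 2.2 and Thm. 2.3 (pp. 79–80)] [cite: PapikianRabinoff2016, §3 ¶23–¶25, Thm. 30 (arXiv:1212.3574 pp. 8–9)]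
-/

set_option linter.dupNamespace false
set_option autoImplicit false

namespace Summit.BirchSwinnertonDyer.BirchSwinnertonDyer.Theorems.LeafPartnerOrders

/-! ## The denominator of the orthogonal idempotent on the character lattice -/

section Denominator

variable {XJ : Type*} [AddCommGroup XJ] (uJ : XJ →ₗ[ℤ] XJ →ₗ[ℤ] ℤ)

/-- **PR's `r` = Takahashi's `h/i`.** In the abstract setting of `Takahashi2001.exists_index_formula` — `u_J` a `ℤ`-bilinear pairing
on `X_J`, `g ∈ X_J`, `i > 0` the generator of the ideal `{u_J(g, y) : y}` (Lemma 2.2), `i ∣ h := u_J(g, g)` — an integer `a` makes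
`a·e_g` integral on `X_J`, where `e_g(y) = (u_J(g,y)/h)·g` is the orthogonal idempotent onto the `g`-line (`g` primitive), i.e.
`h ∣ a·u_J(g, y)` for every `y`, IF AND ONLY IF `h/i ∣ a`. Hence the denominator of `e_g` on `X_J` (Papikian–Rabinoff's `r`, §3 ¶23;
`= [Λ : λ^⊥ ⊕ ℤλ]`, Thm. 30) is `h/i`. [cite: PapikianRabinoff2016, §3 ¶23 and Thm. 30 (4)⟺(7)] [cite: Takahashi2001, Lemma 2.2] -/
theorem forall_dvd_mul_pairing_iff {g : XJ} {i : ℕ} (hi : 0 < i)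
    (hI : LinearMap.range (uJ g) = Ideal.span {(i : ℤ)}) (hih : (i : ℤ) ∣ uJ g g) (a : ℤ) :
    (∀ y : XJ, uJ g g ∣ a * uJ g y) ↔ uJ g g / i ∣ a := by
  obtain ⟨R, hR⟩ := hih
  have hi0 : (i : ℤ) ≠ 0 := by exact_mod_cast hi.ne'
  have hRdef : uJ g g / i = R := by rw [hR, Int.mul_ediv_cancel_left _ hi0]
  rw [hRdef]
  constructor
  · intro h
    -- the generator `i` is attained: `u_J(g, y₁) = i`
    have hmem : (i : ℤ) ∈ LinearMap.range (uJ g) := by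
      rw [hI]; exact Ideal.mem_span_singleton_self _
    obtain ⟨y₁, hy₁⟩ := LinearMap.mem_range.mp hmem
    have h₁ := h y₁
    rw [hy₁, hR, mul_comm a] at h₁
    exact (mul_dvd_mul_iff_left hi0).mp h₁
  · intro h y
    have hy : uJ g y ∈ LinearMap.range (uJ g) := LinearMap.mem_range_self _ y
    rw [hI, Ideal.mem_span_singleton] at hy
    obtain ⟨k, hk⟩ := hy
    rw [hk, hR]
    calc (i : ℤ) * R ∣ i * a := mul_dvd_mul_left _ h
      _ ∣ a * (i * k) := ⟨k, by ring⟩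

end Denominator

/-! ## The fifth property in coordinates: `ℓ ∤ j ⟺ ord_ℓ δ = ord_ℓ (h/i) ⟺ ord_ℓ δ + ord_ℓ c = ord_ℓ h` -/

section Valuation

variable {p : ℕ} [Fact p.Prime]

/-- **`ℓ ∤ j ⟺ ord_ℓ δ = ord_ℓ (h/i)`.** From Takahashi's Thm. 2.3 `δ·i = h·j` with `i ∣ h`, `i > 0`, `δ > 0`: the cokernel order `j`
is prime to `ℓ` iff the degree `δ` and the denominator `R = h/i` of the idempotent have the same `ℓ`-adic valuation (`δ = R·j`). With
`j = cJ P r` (the unique solution of the discriminant system), `δ = δ_{qr,M}`, this is the (G3♭ˢ) fifth property `3 ∤ cJ P r` in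
coordinates. [cite: Takahashi2001, Thm. 2.3] [cite: PapikianRabinoff2016, (3.?) `c = n/r` (§3 ¶25) and Thm. 30] -/
theorem not_dvd_iff_padicValNat_eq {δ i h j : ℕ} (hi : 0 < i) (hδ : 0 < δ) (hih : i ∣ h)
    (hδi : δ * i = h * j) :
    ¬ p ∣ j ↔ padicValNat p δ = padicValNat p (h / i) := by
  obtain ⟨R, hR⟩ := hih
  have hRi : h / i = R := by rw [hR, Nat.mul_div_cancel_left _ hi]
  have hδR : δ = R * j := by
    have h1 : δ * i = (R * j) * i := by rw [hδi, hR]; ring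
    exact Nat.eq_of_mul_eq_mul_right hi h1
  have hj : j ≠ 0 := by
    rintro rfl
    rw [mul_zero] at hδR
    omega
  have hR0 : R ≠ 0 := by
    rintro rfl
    rw [zero_mul] at hδR
    omega
  rw [hRi, hδR, padicValNat.mul hR0 hj]
  constructor
  · intro hnd
    rw [padicValNat.eq_zero_of_not_dvd hnd, add_zero]
  · intro heq
    have h0 : padicValNat p j = 0 := by omega
    rcases padicValNat.eq_zero_iff.mp h0 with h1 | h1 | h1
    · exact absurd h1 (Fact.out : p.Prime).one_lt.ne'
    · exact absurd h1 hj
    · exact h1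

/-- **`ℓ ∤ j ⟺ ord_ℓ δ + ord_ℓ c = ord_ℓ h`** — the instrument form. From `i·j = c` and `δ·i = h·j` (`i, δ > 0`): `j` is prime to `ℓ`
iff `ord_ℓ δ + ord_ℓ c = ord_ℓ h` (`δ·c = h·j²`). This is how the (G3) instrument reads a pair (`δ_{qr,M}`, `c_r(A)`, `ξ`).
[cite: Takahashi2001, Thm. 2.3] [cite: PapikianRabinoff2016, Thm. 30 (5)] -/
theorem padicValNat_add_eq_iff_not_dvd {δ i h j c : ℕ} (hi : 0 < i) (hδ : 0 < δ) (hij : i * j = c)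
    (hδi : δ * i = h * j) :
    padicValNat p δ + padicValNat p c = padicValNat p h ↔ ¬ p ∣ j := by
  have hj : j ≠ 0 := by
    rintro rfl
    rw [mul_zero] at hδi
    rcases Nat.mul_eq_zero.mp hδi with h1 | h1 <;> omega
  have hc : c ≠ 0 := by rw [← hij]; exact Nat.mul_ne_zero hi.ne' hj
  have hh : h ≠ 0 := by
    rintro rfl
    rw [zero_mul] at hδi
    rcases Nat.mul_eq_zero.mp hδi with h1 | h1 <;> omega
  -- `δ c = h j²`
  have key : δ * c = h * (j * j) := by
    calc δ * c = δ * i * j := by rw [← hij, mul_assoc]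
      _ = h * j * j := by rw [hδi]
      _ = h * (j * j) := by rw [mul_assoc]
  have hval : padicValNat p δ + padicValNat p c = padicValNat p h + 2 * padicValNat p j := by
    have := congrArg (padicValNat p) key
    rwa [padicValNat.mul hδ.ne' hc, padicValNat.mul hh (Nat.mul_ne_zero hj hj), padicValNat.mul hj hj, ← two_mul] at this
  rw [hval]
  constructor
  · intro heq
    have h0 : padicValNat p j = 0 := by omega
    rcases padicValNat.eq_zero_iff.mp h0 with h1 | h1 | h1
    · exact absurd h1 (Fact.out : p.Prime).one_lt.ne'
    · exact absurd h1 hj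
    · exact h1
  · intro hnd
    rw [padicValNat.eq_zero_of_not_dvd hnd, mul_zero, add_zero]

end Valuation

end Summit.BirchSwinnertonDyer.BirchSwinnertonDyer.Theorems.LeafPartnerOrders
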